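import Literature.Geometry.Kaehler.RiemannSurfaceGaloisClosure
import Literature.Geometry.Kaehler.RiemannSurfaceAutomorphismGroup
import Literature.Topology.CoveringSpaces.CoveringDeckTransformations
import HarnessLib

/-!
# Classification of the unramified holomorphic coverings of a compact Riemann surface by subgroups of `π₁` (Hatcher 1.37–1.39, holomorphic form)

Topic `Literature/Geometry/Kaehler` — sequel of `RiemannSurfaceGaloisClosure` (§1–§2 there: an unramified
holomorphic covering map of compact connected Riemann surfaces is a local biholomorphism, so continuous maps over it
are holomorphic — Forster 4.6) and of `RiemannSurfaceSubgroupCovering` (existence: every subgroup of finite index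
of `π₁(N, x₀)` is `q_* π₁(Y, y)` for a compact Riemann surface `Y` covering `N` holomorphically), over the lane's
TOPOLOGICAL classification `Topology/CoveringSpaces/CoveringConnectedClassification` (Hatcher Prop. 1.37,
Thm. 1.38: pointed connected covers are isomorphic iff `p₁_* π₁ = p₂_* π₁`, unpointed iff conjugate; the
ordering remark) and `CoveringDeckTransformations` ∕ `Kaehler/ComplexTorusDeckTransformations` (the deck group
`G(Y) ≤ Homeo(Y)`).

Setting: `N` a compact connected Riemann surface; `q₁ : Y₁ → N`, `q₂ : Y₂ → N` HOLOMORPHIC topological covering maps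
from compact connected Riemann surfaces (any universes); `eᵢ ∈ qᵢ⁻¹(x)` base points;
`Hᵢ = qᵢ_* π₁(Yᵢ, eᵢ) ≤ π₁(N, x)` (`FundamentalGroup.mapOfEq`).

## What is proved (everything; no definitions, no instances, no named facts)

* §1 **`mdifferentiable_of_map_over`** — every continuous map `f : Y₁ → Y₂` over `N` is holomorphic, a
  covering map, and onto (Forster 4.6 + Hatcher Ex. 1.3.16);
* §2 **`exists_mdifferentiable_map_iff_range_mapOfEq_le`** — a holomorphic map `(Y₁, e₁) → (Y₂, e₂)` over `N`
  exists iff `H₁ ≤ H₂` (the ordering of coverings), and it is unique (`ConnectedCover.map_unique`);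
  **`exists_biholomorph_apply_eq_iff_range_mapOfEq_eq`** — `(Y₁, e₁) ≅ (Y₂, e₂)` BIHOLOMORPHICALLY over `N` iff
  `H₁ = H₂` (Prop. 1.37 ∕ Thm. 1.38, pointed, holomorphic form);
* §3 **`exists_biholomorph_iff_exists_conj`** — `Y₁ ≅ Y₂` biholomorphically over `N` iff `H₁`, `H₂` are
  conjugate in `π₁(N, x)` (Thm. 1.38 unpointed); `ncard_preimage_eq_of_biholomorph` (then the sheet numbers agree);
* §4 **`exists_unique_covering_of_subgroup`** — for every `H ≤ π₁(N, x₀)` of finite index there is a compact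
  connected Riemann surface `Y` with a holomorphic covering `q : Y → N`, `y ∈ q⁻¹(x₀)`, `q_* π₁(Y, y) = H`, and it
  is unique up to a base-point preserving biholomorphism over `N` among ALL such (in any universe): the
  holomorphic Galois correspondence «finite-index subgroups of `π₁(N, x₀)` ↔ pointed unramified holomorphic
  finite coverings of `N` by compact connected Riemann surfaces» is a bijection;
* §5 **`mdifferentiable_of_mem_deckTransformations`**, **`exists_monoidHom_deckTransformations_autGroup`** — deck
  transformations of `q₁` are conformal automorphisms: an injective homomorphism `G(Y₁) ↪ Aut Y₁`
  (`RiemannSurface.autGroup`) compatible with the actions; `natCard_deckTransformations_le_index` (`#G(Y₁) ≤`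
  number of sheets `= [π₁(N, x) : H₁]`, with equality iff `H₁` is normal — `CoverDeck`).

## References
* A. Hatcher, *Algebraic Topology*, CUP 2002, §1.3 Prop. 1.33, 1.34 (pp. 61–62), Prop. 1.37, Thm. 1.38 (p. 67),
  Prop. 1.39 (p. 71), Exercise 16 (p. 80). [HatcherAT2002]
* O. Forster, *Lectures on Riemann Surfaces*, GTM 81, Springer 1981, §4 Thm. 4.6, §5. [Forster1981]
* H. M. Farkas, I. Kra, *Riemann Surfaces*, 2nd ed., GTM 71, Springer 1992, III.7.7, IV.5. [FarkasKra1992]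
-/

noncomputable section

open Set Function Filter TopologicalSpace MulAction
open _root_.Topology
open scoped Manifold ContDiff

namespace Literature.Geometry.Kaehler

open Literature.Topology.CoveringSpaces Literature.Topology.CoveringSpaces.ConnectedCover
open Literature.Geometry.Kaehler.ComplexTorus (deckTransformations mem_deckTransformations_iff)

namespace RiemannSurface

universe u v w

variable {N : Type u} [TopologicalSpace N] [ChartedSpace ℂ N] [ConnectedSpace N] [IsManifold 𝓘(ℂ, ℂ) ω N]
  [CompactSpace N] [T2Space N]
  {Y₁ : Type v} [TopologicalSpace Y₁] [ChartedSpace ℂ Y₁] [ConnectedSpace Y₁] [IsManifold 𝓘(ℂ, ℂ) ω Y₁]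
  [CompactSpace Y₁] [T2Space Y₁]
  {Y₂ : Type w} [TopologicalSpace Y₂] [ChartedSpace ℂ Y₂] [ConnectedSpace Y₂] [IsManifold 𝓘(ℂ, ℂ) ω Y₂]
  [CompactSpace Y₂] [T2Space Y₂]
  {q₁ : Y₁ → N} {q₂ : Y₂ → N}

/-! ### §1 Maps of unramified holomorphic coverings are holomorphic covering maps -/

omit [CompactSpace N] [IsManifold 𝓘(ℂ, ℂ) ω Y₁] [T2Space Y₁] in
/-- **A continuous map of unramified holomorphic coverings of a compact Riemann surface is a holomorphic surjective
covering map**: for holomorphic covering maps `q₁ : Y₁ → N`, `q₂ : Y₂ → N` of compact connected Riemann surfaces and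
a continuous `f : Y₁ → Y₂` with `q₂ ∘ f = q₁`, the map `f` is holomorphic (Forster 4.6: `q₂` is a local
biholomorphism, `isLocalDiffeomorph_of_isCoveringMap`), a covering map (Hatcher Ex. 1.3.16) and onto (`Y₂` connected,
fibres finite). [cite: Forster1981, §4 Thm. 4.6] [cite: HatcherAT2002, §1.3 Exercise 16 (p. 80)] -/
theorem mdifferentiable_of_map_over (hq₁ : IsCoveringMap q₁) (h₁ : MDifferentiable 𝓘(ℂ, ℂ) 𝓘(ℂ, ℂ) q₁)
    (hq₂ : IsCoveringMap q₂) (h₂ : MDifferentiable 𝓘(ℂ, ℂ) 𝓘(ℂ, ℂ) q₂) {f : Y₁ → Y₂} (hf : Continuous f)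
    (hfq : ∀ e, q₂ (f e) = q₁ e) :
    MDifferentiable 𝓘(ℂ, ℂ) 𝓘(ℂ, ℂ) f ∧ IsCoveringMap f ∧ Surjective f := by
  haveI := ChartedSpace.locallyPathConnectedSpace ℂ N
  have hfc : IsCoveringMap f := hq₁.of_comp_eq hq₂ hf hfq
  exact ⟨mdifferentiable_of_comp_eq_of_isCoveringMap h₂ hq₂ h₁ hf hfq, hfc,
    hfc.surjective_of_finite hfc.finite_preimage_singleton_of_compactSpace⟩

omit [TopologicalSpace N] [ChartedSpace ℂ N] [ConnectedSpace N] [IsManifold 𝓘(ℂ, ℂ) ω N] [CompactSpace N]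
  [T2Space N] [TopologicalSpace Y₁] [ChartedSpace ℂ Y₁] [ConnectedSpace Y₁] [IsManifold 𝓘(ℂ, ℂ) ω Y₁]
  [CompactSpace Y₁] [T2Space Y₁] [TopologicalSpace Y₂] [ChartedSpace ℂ Y₂] [ConnectedSpace Y₂]
  [IsManifold 𝓘(ℂ, ℂ) ω Y₂] [CompactSpace Y₂] [T2Space Y₂] in
/-- The inverse of a bijection over `N` is over `N`. [cite: HatcherAT2002, §1.3 Thm. 1.38] -/
private theorem symm_over (f : Y₁ ≃ Y₂) (hf : ∀ e, q₂ (f e) = q₁ e) (e : Y₂) : q₁ (f.symm e) = q₂ e := by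
  conv_rhs => rw [← f.apply_symm_apply e]
  exact (hf _).symm

omit [CompactSpace N] [T2Space Y₁] [T2Space Y₂] in
/-- **An isomorphism of unramified holomorphic coverings is a biholomorphism**: a homeomorphism `f : Y₁ ≃ₜ Y₂` over
`N` and its inverse are holomorphic. [cite: Forster1981, §4 Thm. 4.6] [cite: HatcherAT2002, §1.3 Thm. 1.38] -/
theorem mdifferentiable_homeomorph_over (hq₁ : IsCoveringMap q₁) (h₁ : MDifferentiable 𝓘(ℂ, ℂ) 𝓘(ℂ, ℂ) q₁)
    (hq₂ : IsCoveringMap q₂) (h₂ : MDifferentiable 𝓘(ℂ, ℂ) 𝓘(ℂ, ℂ) q₂) (f : Y₁ ≃ₜ Y₂)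
    (hf : ∀ e, q₂ (f e) = q₁ e) :
    MDifferentiable 𝓘(ℂ, ℂ) 𝓘(ℂ, ℂ) f ∧ MDifferentiable 𝓘(ℂ, ℂ) 𝓘(ℂ, ℂ) f.symm :=
  ⟨mdifferentiable_of_comp_eq_of_isCoveringMap h₂ hq₂ h₁ f.continuous hf,
    mdifferentiable_of_comp_eq_of_isCoveringMap h₁ hq₁ h₂ f.symm.continuous (symm_over f.toEquiv hf)⟩

/-! ### §2 Pointed classification: `H₁ ≤ H₂`, `H₁ = H₂` -/

omit [CompactSpace N] [IsManifold 𝓘(ℂ, ℂ) ω Y₁] [T2Space Y₁] in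
/-- **The ordering of unramified holomorphic coverings** (Hatcher, remark after Thm. 1.38, holomorphic form): a
HOLOMORPHIC map `(Y₁, e₁) → (Y₂, e₂)` over `N` exists iff `q₁_* π₁(Y₁, e₁) ≤ q₂_* π₁(Y₂, e₂)`; it is then a
surjective covering map, and unique (`ConnectedCover.map_unique`, Prop. 1.34).
[cite: HatcherAT2002, §1.3 Prop. 1.33, remark after Thm. 1.38 (p. 67)] [cite: Forster1981, §4 Thm. 4.6] -/
theorem exists_mdifferentiable_map_iff_range_mapOfEq_le (hq₁ : IsCoveringMap q₁)
    (h₁ : MDifferentiable 𝓘(ℂ, ℂ) 𝓘(ℂ, ℂ) q₁) (hq₂ : IsCoveringMap q₂) (h₂ : MDifferentiable 𝓘(ℂ, ℂ) 𝓘(ℂ, ℂ) q₂)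
    {x : N} (e₁ : q₁ ⁻¹' {x}) (e₂ : q₂ ⁻¹' {x}) :
    (∃ f : Y₁ → Y₂, MDifferentiable 𝓘(ℂ, ℂ) 𝓘(ℂ, ℂ) f ∧ IsCoveringMap f ∧ Surjective f ∧
        (∀ e, q₂ (f e) = q₁ e) ∧ f e₁ = e₂) ↔
      (FundamentalGroup.mapOfEq ⟨q₁, hq₁.continuous⟩ e₁.2).range ≤
        (FundamentalGroup.mapOfEq ⟨q₂, hq₂.continuous⟩ e₂.2).range := by
  haveI := pathConnectedSpace_of_connectedSpace Y₁
  haveI := ChartedSpace.locallyPathConnectedSpace ℂ Y₁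
  rw [← exists_map_iff_range_mapOfEq_le hq₁ hq₂ e₁ e₂]
  constructor
  · rintro ⟨f, hfd, -, -, hfq, hfe⟩
    exact ⟨f, hfd.continuous, hfq, hfe⟩
  · rintro ⟨f, hfc, hfq, hfe⟩
    obtain ⟨hfd, hfcov, hfs⟩ := mdifferentiable_of_map_over hq₁ h₁ hq₂ h₂ hfc hfq
    exact ⟨f, hfd, hfcov, hfs, hfq, hfe⟩

omit [CompactSpace N] [T2Space Y₁] [T2Space Y₂] in
/-- **Hatcher Prop. 1.37 ∕ Thm. 1.38 (pointed), holomorphic form**: two unramified holomorphic coverings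
`qᵢ : Yᵢ → N` of a compact Riemann surface by compact connected Riemann surfaces, with base points `e₁, e₂` over `x`,
are BIHOLOMORPHIC over `N` by a map taking `e₁` to `e₂` iff `q₁_* π₁(Y₁, e₁) = q₂_* π₁(Y₂, e₂)`.
[cite: HatcherAT2002, §1.3 Prop. 1.37, Thm. 1.38 (p. 67)] [cite: Forster1981, §4 Thm. 4.6] -/
theorem exists_biholomorph_apply_eq_iff_range_mapOfEq_eq (hq₁ : IsCoveringMap q₁)
    (h₁ : MDifferentiable 𝓘(ℂ, ℂ) 𝓘(ℂ, ℂ) q₁) (hq₂ : IsCoveringMap q₂) (h₂ : MDifferentiable 𝓘(ℂ, ℂ) 𝓘(ℂ, ℂ) q₂)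
    {x : N} (e₁ : q₁ ⁻¹' {x}) (e₂ : q₂ ⁻¹' {x}) :
    (∃ f : Y₁ ≃ₜ Y₂, MDifferentiable 𝓘(ℂ, ℂ) 𝓘(ℂ, ℂ) f ∧ MDifferentiable 𝓘(ℂ, ℂ) 𝓘(ℂ, ℂ) f.symm ∧
        (∀ e, q₂ (f e) = q₁ e) ∧ f e₁ = e₂) ↔
      (FundamentalGroup.mapOfEq ⟨q₁, hq₁.continuous⟩ e₁.2).range =
        (FundamentalGroup.mapOfEq ⟨q₂, hq₂.continuous⟩ e₂.2).range := by
  haveI := pathConnectedSpace_of_connectedSpace Y₁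
  haveI := ChartedSpace.locallyPathConnectedSpace ℂ Y₁
  haveI := pathConnectedSpace_of_connectedSpace Y₂
  haveI := ChartedSpace.locallyPathConnectedSpace ℂ Y₂
  rw [← exists_homeomorph_apply_eq_iff_range_mapOfEq_eq hq₁ hq₂ e₁ e₂]
  constructor
  · rintro ⟨f, -, -, hfq, hfe⟩
    exact ⟨f, hfq, hfe⟩
  · rintro ⟨f, hfq, hfe⟩
    obtain ⟨hfd, hfs⟩ := mdifferentiable_homeomorph_over hq₁ h₁ hq₂ h₂ f hfq
    exact ⟨f, hfd, hfs, hfq, hfe⟩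

/-! ### §3 Unpointed classification: conjugate subgroups -/

omit [CompactSpace N] [T2Space Y₁] [T2Space Y₂] in
/-- **Hatcher Thm. 1.38 (unpointed), holomorphic form**: two unramified holomorphic coverings of a compact Riemann
surface by compact connected Riemann surfaces are biholomorphic over `N` iff the subgroups `q₁_* π₁(Y₁, e₁)`,
`q₂_* π₁(Y₂, e₂)` (any base points over one `x`) are conjugate in `π₁(N, x)`.
[cite: HatcherAT2002, §1.3 Thm. 1.38 (p. 67)] [cite: Forster1981, §4 Thm. 4.6] -/
theorem exists_biholomorph_iff_exists_conj (hq₁ : IsCoveringMap q₁) (h₁ : MDifferentiable 𝓘(ℂ, ℂ) 𝓘(ℂ, ℂ) q₁)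
    (hq₂ : IsCoveringMap q₂) (h₂ : MDifferentiable 𝓘(ℂ, ℂ) 𝓘(ℂ, ℂ) q₂) {x : N} (e₁ : q₁ ⁻¹' {x})
    (e₂ : q₂ ⁻¹' {x}) :
    (∃ f : Y₁ ≃ₜ Y₂, MDifferentiable 𝓘(ℂ, ℂ) 𝓘(ℂ, ℂ) f ∧ MDifferentiable 𝓘(ℂ, ℂ) 𝓘(ℂ, ℂ) f.symm ∧
        ∀ e, q₂ (f e) = q₁ e) ↔
      ∃ γ : FundamentalGroup N x, (FundamentalGroup.mapOfEq ⟨q₂, hq₂.continuous⟩ e₂.2).range =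
        (FundamentalGroup.mapOfEq ⟨q₁, hq₁.continuous⟩ e₁.2).range.map (MulAut.conj γ).toMonoidHom := by
  haveI := pathConnectedSpace_of_connectedSpace Y₁
  haveI := ChartedSpace.locallyPathConnectedSpace ℂ Y₁
  haveI := pathConnectedSpace_of_connectedSpace Y₂
  haveI := ChartedSpace.locallyPathConnectedSpace ℂ Y₂
  rw [← exists_homeomorph_iff_exists_conj hq₁ hq₂ e₁ e₂]
  constructor
  · rintro ⟨f, -, -, hfq⟩
    exact ⟨f, hfq⟩
  · rintro ⟨f, hfq⟩
    obtain ⟨hfd, hfs⟩ := mdifferentiable_homeomorph_over hq₁ h₁ hq₂ h₂ f hfq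
    exact ⟨f, hfd, hfs, hfq⟩

omit [TopologicalSpace N] [ChartedSpace ℂ N] [ConnectedSpace N] [IsManifold 𝓘(ℂ, ℂ) ω N] [CompactSpace N] [T2Space N]
  [ChartedSpace ℂ Y₁] [ConnectedSpace Y₁] [IsManifold 𝓘(ℂ, ℂ) ω Y₁] [CompactSpace Y₁] [T2Space Y₁] [ChartedSpace ℂ Y₂]
  [ConnectedSpace Y₂] [IsManifold 𝓘(ℂ, ℂ) ω Y₂] [CompactSpace Y₂] [T2Space Y₂] in
/-- Coverings isomorphic over `N` have the same number of points in each fibre.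
[cite: HatcherAT2002, §1.3 Thm. 1.38] -/
theorem ncard_preimage_eq_of_homeomorph_over (f : Y₁ ≃ₜ Y₂) (hf : ∀ e, q₂ (f e) = q₁ e) (y : N) :
    (q₁ ⁻¹' {y}).ncard = (q₂ ⁻¹' {y}).ncard :=
  natCard_fiber_eq_of_homeomorph f hf y

/-! ### §4 The holomorphic Galois correspondence: existence and uniqueness for a subgroup of finite index -/

omit [IsManifold 𝓘(ℂ, ℂ) ω N] [CompactSpace N] [T2Space N] [IsManifold 𝓘(ℂ, ℂ) ω Y₁] [CompactSpace Y₁] [T2Space Y₁] in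
/-- **The number of sheets of an unramified holomorphic covering is the index `[π₁(N, x) : q_* π₁(Y, e)]`**, at
every point of `N` (Hatcher Prop. 1.32, all fibres being equipotent over the connected `N`).
[cite: HatcherAT2002, §1.3 Prop. 1.32 (p. 61)] -/
theorem ncard_preimage_eq_index_range_mapOfEq (hq₁ : IsCoveringMap q₁) {x : N} (e₁ : q₁ ⁻¹' {x}) (y : N) :
    (q₁ ⁻¹' {y}).ncard = (FundamentalGroup.mapOfEq ⟨q₁, hq₁.continuous⟩ e₁.2).range.index := by
  haveI := pathConnectedSpace_of_connectedSpace Y₁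
  haveI := pathConnectedSpace_of_connectedSpace N
  rw [CoverMonodromy.index_range_mapOfEq_eq_natCard_fiber hq₁ e₁, hq₁.natCard_preimage_singleton_eq x y]
  rfl

/-- **The holomorphic Galois correspondence for a compact Riemann surface** (finite part, pointed): for every
subgroup `H ≤ π₁(N, x₀)` of finite index there are a compact connected Riemann surface `Y` (in the universe of `N`),
a holomorphic covering map `q : Y → N` and `y ∈ q⁻¹(x₀)` with `q_* π₁(Y, y) = H` and `[π₁ : H]` sheets
(`RiemannSurface.exists_covering_of_subgroup`, Hatcher 1.36 + Forster 4.6) — and `(Y, q, y)` is UNIQUE up to a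
base-point preserving biholomorphism over `N` among all compact connected Riemann surfaces covering `N`
holomorphically with this subgroup, in any universe (Prop. 1.37, holomorphic form).
[cite: HatcherAT2002, §1.3 Prop. 1.36 (p. 68), Prop. 1.37, Thm. 1.38 (p. 67)] [cite: Forster1981, §4 Thm. 4.6] -/
theorem exists_unique_covering_of_subgroup (x₀ : N) (H : Subgroup (FundamentalGroup N x₀)) [H.FiniteIndex] :
    ∃ (Y : Type u) (_ : TopologicalSpace Y) (_ : ChartedSpace ℂ Y) (_ : IsManifold 𝓘(ℂ, ℂ) ω Y)
      (_ : CompactSpace Y) (_ : T2Space Y) (_ : ConnectedSpace Y) (q : Y → N) (hq : IsCoveringMap q)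
      (y : Y) (hy : q y = x₀),
      MDifferentiable 𝓘(ℂ, ℂ) 𝓘(ℂ, ℂ) q ∧ (∀ x, (q ⁻¹' {x}).ncard = H.index) ∧
        (FundamentalGroup.mapOfEq (⟨q, hq.continuous⟩ : C(Y, N)) hy).range = H ∧
        ∀ (Y' : Type w) [TopologicalSpace Y'] [ChartedSpace ℂ Y'] [ConnectedSpace Y'] [IsManifold 𝓘(ℂ, ℂ) ω Y']
          [CompactSpace Y'] (q' : Y' → N) (hq' : IsCoveringMap q')
          (_ : MDifferentiable 𝓘(ℂ, ℂ) 𝓘(ℂ, ℂ) q') (y' : Y') (hy' : q' y' = x₀),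
          (FundamentalGroup.mapOfEq (⟨q', hq'.continuous⟩ : C(Y', N)) hy').range = H →
            ∃ f : Y' ≃ₜ Y, MDifferentiable 𝓘(ℂ, ℂ) 𝓘(ℂ, ℂ) f ∧ MDifferentiable 𝓘(ℂ, ℂ) 𝓘(ℂ, ℂ) f.symm ∧
              (∀ e, q (f e) = q' e) ∧ f y' = y := by
  obtain ⟨Y, i1, i2, i3, i4, i5, i6, q, hq, y, hy, hqd, -, hcard, -, hrange, -⟩ := exists_covering_of_subgroup x₀ H
  refine ⟨Y, i1, i2, i3, i4, i5, i6, q, hq, y, hy, hqd, hcard, hrange, ?_⟩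
  intro Y' _ _ _ _ _ q' hq' hq'd y' hy' hrange'
  obtain ⟨f, hfd, hfs, hfq, hfe⟩ := (exists_biholomorph_apply_eq_iff_range_mapOfEq_eq hq' hq'd hq hqd
    (⟨y', hy'⟩ : q' ⁻¹' {x₀}) (⟨y, hy⟩ : q ⁻¹' {x₀})).2 (hrange'.trans hrange.symm)
  exact ⟨f, hfd, hfs, hfq, hfe⟩

/-! ### §5 Deck transformations are conformal automorphisms -/

omit [CompactSpace N] [T2Space Y₁] in
/-- **Deck transformations of an unramified holomorphic covering are biholomorphic** (`f ∈ G(Y₁)`, i.e.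
`q₁ ∘ f = q₁`, is holomorphic with holomorphic inverse). [cite: Forster1981, §4 Thm. 4.6, §5]
[cite: HatcherAT2002, §1.3 Prop. 1.39 (p. 71)] -/
theorem mdifferentiable_of_mem_deckTransformations (hq₁ : IsCoveringMap q₁)
    (h₁ : MDifferentiable 𝓘(ℂ, ℂ) 𝓘(ℂ, ℂ) q₁) {f : Y₁ ≃ₜ Y₁} (hf : f ∈ deckTransformations q₁) :
    MDifferentiable 𝓘(ℂ, ℂ) 𝓘(ℂ, ℂ) f ∧ MDifferentiable 𝓘(ℂ, ℂ) 𝓘(ℂ, ℂ) f.symm :=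
  mdifferentiable_homeomorph_deck h₁ hq₁ f (funext hf)

omit [CompactSpace N] [T2Space Y₁] in
/-- **The deck group embeds in the automorphism group**: for an unramified holomorphic covering `q₁ : Y₁ → N` of
compact connected Riemann surfaces there is an injective homomorphism `G(Y₁) →* Aut Y₁`
(`RiemannSurface.autGroup`, the conformal automorphisms) acting as the deck transformations do.
[cite: FarkasKra1992, III.7.7] [cite: HatcherAT2002, §1.3 Prop. 1.39 (p. 71)] [cite: Forster1981, §5] -/
theorem exists_monoidHom_deckTransformations_autGroup (hq₁ : IsCoveringMap q₁)
    (h₁ : MDifferentiable 𝓘(ℂ, ℂ) 𝓘(ℂ, ℂ) q₁) :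
    ∃ ι : deckTransformations q₁ →* autGroup Y₁, Injective ι ∧
      ∀ (f : deckTransformations q₁) (y : Y₁), ((ι f : autGroup Y₁) : Equiv.Perm Y₁) y = (f : Y₁ ≃ₜ Y₁) y := by
  let ι : deckTransformations q₁ →* autGroup Y₁ :=
    { toFun := fun f ↦ ⟨(f : Y₁ ≃ₜ Y₁).toEquiv, mdifferentiable_of_mem_deckTransformations hq₁ h₁ f.2⟩
      map_one' := Subtype.ext (Equiv.ext fun _ ↦ rfl)
      map_mul' := fun _ _ ↦ Subtype.ext (Equiv.ext fun _ ↦ rfl) }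
  refine ⟨ι, fun f g hfg ↦ ?_, fun _ _ ↦ rfl⟩
  have h : (f : Y₁ ≃ₜ Y₁).toEquiv = (g : Y₁ ≃ₜ Y₁).toEquiv := congrArg (fun σ : autGroup Y₁ ↦ (σ : Equiv.Perm Y₁)) hfg
  exact Subtype.ext (Homeomorph.toEquiv_injective h)

omit [ChartedSpace ℂ N] [ConnectedSpace N] [IsManifold 𝓘(ℂ, ℂ) ω N] [CompactSpace N] [T2Space N] [ChartedSpace ℂ Y₁]
  [IsManifold 𝓘(ℂ, ℂ) ω Y₁] [CompactSpace Y₁] [T2Space Y₁] in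
/-- **`#G(Y₁) ≤` the number of sheets** of a connected covering (`= [π₁(N, x) : q₁_* π₁(Y₁, e₁)]`): the deck group
acts freely on the fibre `q₁⁻¹(x)` (a deck transformation is determined by the image of one point, Prop. 1.34).
[cite: HatcherAT2002, §1.3 Prop. 1.34, Prop. 1.39 (p. 71)] -/
theorem natCard_deckTransformations_le_natCard_preimage [LocallyConnectedSpace Y₁] (hq₁ : IsCoveringMap q₁)
    {x : N} (e₁ : q₁ ⁻¹' {x}) [Finite (q₁ ⁻¹' {x})] :
    Nat.card (deckTransformations q₁) ≤ Nat.card (q₁ ⁻¹' {x}) := by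
  haveI := (inferInstance : ConnectedSpace Y₁).toPreconnectedSpace
  -- `f ↦ f e₁` is injective `G(Y₁) → q₁⁻¹(x)`
  refine Nat.card_le_card_of_injective
    (fun f : deckTransformations q₁ ↦ (⟨(f : Y₁ ≃ₜ Y₁) e₁, by
      rw [mem_preimage, (mem_deckTransformations_iff q₁ _).1 f.2]; exact e₁.2⟩ : q₁ ⁻¹' {x})) fun f g hfg ↦ ?_
  exact Subtype.ext (ComplexTorus.deck_eq_of_apply_eq hq₁ f.2 g.2 (congrArg Subtype.val hfg))

end RiemannSurface

end Literature.Geometry.Kaehler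

end
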